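import Literature.Analysis.OperatorTheory.Enflo2023.Basic
import Literature.Analysis.OperatorTheory.Enflo2023.WeakLimitStep
import Literature.Analysis.InnerProduct.WeakSubsequence
import HarnessLib

/-!
# Enflo 2023, repair census: for a COMPACT operator the disputed step is not needed

Source under adjudication: Per H. Enflo, *On the invariant subspace problem in Hilbert spaces*, arXiv:2305.15442 (v1
2023, v2 2024), bib key `Enflo2023` — a CLAIMED proof of the invariant subspace problem for operators on a separable
Hilbert space.  This file is part of the kernel-tight typing of the manuscript by the b2b-enflo repair cell
(formaliser 2, Part B: (28)–(47), the limiting argument and the final deduction).  It records what FOLLOWS (proved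
implications from the manuscript's displayed hypotheses) and, where a step does not follow, the typed inference
together with its refutation.  NOTHING here asserts that the manuscript's main theorem holds; no declaration concludes
the invariant subspace problem for an arbitrary operator.  Value (BLOCK-2b): theorems / refutations of typed
inferences about a text — not progress on the problem.

REPAIR-CENSUS entry "T compact" (R8), CLOSED IN LEAN.  The first non-following step of Part B (v2 p.20, after (46):
the room claim, `RoomClaim`, refuted in `RoomClaim.lean`) is used only to upgrade the weakly precompact output
`w_n = ℓ'_n(T)y'_n` of the Main Construction to a NORM-convergent sequence, because the type-1 target
`⟨T^j w_∞, x₀ − w_∞⟩ = 0` is quadratic in `w_∞` and does not pass to weak limits.  For a COMPACT operator it does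
(for `j ≥ 1`): `T` maps the weakly convergent bounded sequence `w_n ⇀ z` to a norm-convergent one
(`tendsto_of_isCompactOperator_of_tendsto_inner`), a norm-convergent factor against a bounded weakly convergent factor has
convergent inner products (`tendsto_inner_of_tendsto_inner_of_tendsto`), so `⟨T^{j+1} z, x₀ − z⟩ = 0` for all
`j ≥ 0`; `z ≠ 0` (from `Re⟨w_n, x₀⟩ ≥ 0.255`), `x₀ − z ≠ 0` (if `z = x₀` the `j = 0` bound forces `‖x₀ − w_n‖ → 0`,
contradicting `‖x₀ − w_n‖ ≥ 0.3`), and the orbit closure of `Tz` is a non-trivial closed invariant subspace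
(`hasNontrivialClosedInvariantSubspace_of_isCompactOperator_weakMC`; with the weakly convergent subsequence extracted
inside Lean: `…_of_isCompactOperator_MC`).  So in the class of compact (injective — a WLOG of the manuscript,
`Reductions.lean`) operators the manuscript's OWN mechanism closes without the room claim.  The conclusion itself is
classical (Aronszajn–Smith 1954, Lomonosov 1973 [cite: Lomonosov1973]) and minimal vectors were already used to
re-prove it with NORM-convergent subsequences by Ansari–Enflo [cite: AnsariEnflo1998]; neither is used here.  The
hypothesis "(εθ)_n → 0 along outputs at distance ∈ [0.3, 0.7] from x₀" is the Main Construction's output as the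
manuscript states it on p.4 (before (11)); its attainability is part of the manuscript's first-order analysis and is NOT
asserted here.
-/

open scoped InnerProductSpace
open Filter Topology RCLike

namespace Literature.Analysis.OperatorTheory.Enflo2023

variable {H : Type*} [NormedAddCommGroup H] [InnerProductSpace ℂ H]

/-- A compact operator maps a bounded weakly convergent sequence to a norm-convergent one (complete continuity,
sequential form). [folklore] -/
theorem tendsto_of_isCompactOperator_of_tendsto_inner [CompleteSpace H] {T : H →L[ℂ] H}
    (hT : IsCompactOperator T) {w : ℕ → H} {z : H} {B : ℝ} (hB : ∀ n, ‖w n‖ ≤ B)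
    (hweak : ∀ v : H, Tendsto (fun n => ⟪v, w n⟫_ℂ) atTop (𝓝 ⟪v, z⟫_ℂ)) :
    Tendsto (fun n => T (w n)) atTop (𝓝 (T z)) := by
  obtain ⟨K, hK, hsub⟩ := hT.image_closedBall_subset_compact (f := (T : H →ₗ[ℂ] H)) B
  have hmem : ∀ n, T (w n) ∈ K := fun n =>
    hsub ⟨w n, by simpa [Metric.mem_closedBall, dist_zero_right] using hB n, rfl⟩
  refine tendsto_of_subseq_tendsto fun ns hns => ?_
  obtain ⟨a, -, φ, hφ, ha⟩ := hK.tendsto_subseq (x := fun k => T (w (ns k))) fun k => hmem (ns k)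
  have haz : a = T z := by
    refine ext_inner_left ℂ fun v => ?_
    have h1 : Tendsto (fun k => ⟪v, T (w (ns (φ k)))⟫_ℂ) atTop (𝓝 ⟪v, a⟫_ℂ) :=
      ((continuous_const.inner continuous_id).tendsto a).comp ha
    have h2 : Tendsto (fun k => ⟪v, T (w (ns (φ k)))⟫_ℂ) atTop (𝓝 ⟪v, T z⟫_ℂ) := by
      have key : ∀ u : H, ⟪v, T u⟫_ℂ = ⟪ContinuousLinearMap.adjoint T v, u⟫_ℂ := fun u => by
        rw [ContinuousLinearMap.adjoint_inner_left]
      simp_rw [key]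
      exact (hweak _).comp (hns.comp hφ.tendsto_atTop)
    exact tendsto_nhds_unique h1 h2
  exact ⟨φ, by simpa [haz, Function.comp_def] using ha⟩

/-- Inner products of a bounded weakly convergent sequence (first slot) against a norm-convergent sequence (second
slot) converge. [folklore] -/
theorem tendsto_inner_of_tendsto_inner_of_tendsto {w : ℕ → H} {z : H} {B : ℝ} (hB : ∀ n, ‖w n‖ ≤ B)
    (hweak : ∀ v : H, Tendsto (fun n => ⟪v, w n⟫_ℂ) atTop (𝓝 ⟪v, z⟫_ℂ)) {b : ℕ → H} {blim : H}
    (hb : Tendsto b atTop (𝓝 blim)) :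
    Tendsto (fun n => ⟪w n, b n⟫_ℂ) atTop (𝓝 ⟪z, blim⟫_ℂ) := by
  have hB0 : 0 ≤ B := (norm_nonneg _).trans (hB 0)
  -- the norm-convergent part
  have h1 : Tendsto (fun n => ⟪w n, b n - blim⟫_ℂ) atTop (𝓝 0) := by
    have hn : Tendsto (fun n => ‖b n - blim‖) atTop (𝓝 0) := (tendsto_iff_norm_sub_tendsto_zero.mp hb)
    refine squeeze_zero_norm (fun n => ?_) (by simpa using hn.const_mul B)
    exact (norm_inner_le_norm _ _).trans (mul_le_mul_of_nonneg_right (hB n) (norm_nonneg _))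
  -- the weakly convergent part, moved to the first slot by conjugation
  have h2 : Tendsto (fun n => ⟪w n, blim⟫_ℂ) atTop (𝓝 ⟪z, blim⟫_ℂ) := by
    have := (continuous_conj.tendsto _).comp (hweak blim)
    simpa [Function.comp_def, inner_conj_symm] using this
  have := h1.add h2
  simp only [zero_add] at this
  refine this.congr fun n => ?_
  rw [inner_sub_right]; ring

omit [InnerProductSpace ℂ H] in
/-- MC outputs stay in the ball of radius `1.7`: `‖x₀‖ = 1`, `‖x₀ − w‖ ≤ 0.7`. [folklore] -/
lemma norm_le_of_norm_sub_le {x₀ w : H} (hx₀ : ‖x₀‖ = 1) (hw : ‖x₀ - w‖ ≤ 0.7) : ‖w‖ ≤ 1.7 := by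
  calc ‖w‖ = ‖x₀ - (x₀ - w)‖ := by rw [sub_sub_cancel]
    _ ≤ ‖x₀‖ + ‖x₀ - w‖ := norm_sub_le _ _
    _ ≤ 1.7 := by rw [hx₀]; linarith

/-- If `‖x₀‖ = 1`, `‖x₀ − w_n‖ ≥ 0.3`, `|⟨w_n, x₀ − w_n⟩| ≤ ε_n → 0` and `w_n ⇀ z`, then `z ≠ x₀`
(were `z = x₀`, the `j = 0` bound would force `‖w_n‖² → 1` and `Re⟨x₀, w_n⟩ → 1`, i.e. `‖x₀ − w_n‖ → 0`).
[cite: Enflo2023, v2 p.4 (11)] -/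
theorem sub_weakLimit_ne_zero {x₀ : H} (hx₀ : ‖x₀‖ = 1) {w : ℕ → H} {z : H} {ε : ℕ → ℝ}
    (hdist : ∀ n, 0.3 ≤ ‖x₀ - w n‖)
    (hweak : ∀ v : H, Tendsto (fun n => ⟪v, w n⟫_ℂ) atTop (𝓝 ⟪v, z⟫_ℂ))
    (hε : Tendsto ε atTop (𝓝 0)) (h0 : ∀ n, ‖⟪x₀ - w n, w n⟫_ℂ‖ ≤ ε n) : x₀ - z ≠ 0 := by
  intro hxz
  have hzx : z = x₀ := (sub_eq_zero.mp hxz).symm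
  have hr : Tendsto (fun n => re ⟪x₀, w n⟫_ℂ) atTop (𝓝 1) := by
    have := (continuous_re.tendsto _).comp (hweak x₀)
    rw [hzx] at this
    simpa [Function.comp_def, inner_self_eq_norm_sq, hx₀] using this
  have hd : Tendsto (fun n => re ⟪x₀ - w n, w n⟫_ℂ) atTop (𝓝 0) :=
    squeeze_zero_norm (fun n => (abs_re_le_norm _).trans (h0 n)) hε
  have hs : Tendsto (fun n => ‖w n‖ ^ 2) atTop (𝓝 1) := by
    have := hr.sub hd
    simp only [sub_zero] at this
    refine this.congr fun n => ?_
    rw [inner_sub_left, map_sub, inner_self_eq_norm_sq]; ring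
  have hlim : Tendsto (fun n => ‖x₀ - w n‖ ^ 2) atTop (𝓝 0) := by
    have := (tendsto_const_nhds (x := (1 : ℝ)).sub (hr.const_mul 2)).add hs
    have e : (1 : ℝ) - 2 * 1 + 1 = 0 := by norm_num
    rw [e] at this
    refine this.congr fun n => ?_
    rw [@norm_sub_sq ℂ _ _ _ _ x₀ (w n), hx₀]; ring
  have : (0.09 : ℝ) ≤ 0 := ge_of_tendsto' hlim fun n => by nlinarith [hdist n, norm_nonneg (x₀ - w n)]
  linarith

/-- REPAIR CENSUS, `T` compact: the type-1 endgame of the Main Construction closes from a WEAK limit.  Hypotheses: `T`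
compact and injective (WLOG, `Reductions.lean`), `‖x₀‖ = 1`, MC outputs `w n` with `0.3 ≤ ‖x₀ − w n‖ ≤ 0.7`, the
minimality consequence (9) `|⟨T^j w_n, x₀ − w_n⟩| ≤ (εθ)_n` for all `j` with `(εθ)_n → 0`, and `w n ⇀ z` weakly.
Conclusion: a non-trivial closed invariant subspace (the orbit closure of `Tz`, orthogonal to `x₀ − z`).  No norm
convergence, no room claim. [cite: Enflo2023, v2 p.4 (11) and p.20] -/
theorem hasNontrivialClosedInvariantSubspace_of_isCompactOperator_weakMC [CompleteSpace H] (T : H →L[ℂ] H)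
    (hTc : IsCompactOperator T) (hT : Function.Injective T) (x₀ : H) (hx₀ : ‖x₀‖ = 1)
    (w : ℕ → H) (z : H) (ε : ℕ → ℝ)
    (hdist : ∀ n, 0.3 ≤ ‖x₀ - w n‖ ∧ ‖x₀ - w n‖ ≤ 0.7)
    (hweak : ∀ v : H, Tendsto (fun n => ⟪v, w n⟫_ℂ) atTop (𝓝 ⟪v, z⟫_ℂ))
    (hε : Tendsto ε atTop (𝓝 0))
    (h : ∀ n j, ‖⟪x₀ - w n, (T ^ j) (w n)⟫_ℂ‖ ≤ ε n) :
    HasNontrivialClosedInvariantSubspace T := by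
  have hB : ∀ n, ‖w n‖ ≤ 1.7 := fun n => norm_le_of_norm_sub_le hx₀ (hdist n).2
  have hB' : ∀ n, ‖x₀ - w n‖ ≤ 0.7 := fun n => (hdist n).2
  have hweak' : ∀ v : H, Tendsto (fun n => ⟪v, x₀ - w n⟫_ℂ) atTop (𝓝 ⟪v, x₀ - z⟫_ℂ) := fun v => by
    simp_rw [inner_sub_right]
    exact tendsto_const_nhds.sub (hweak v)
  -- compactness: T w_n → T z in norm, hence T^{j+1} w_n → T^{j+1} z in norm
  have hTw : Tendsto (fun n => T (w n)) atTop (𝓝 (T z)) := tendsto_of_isCompactOperator_of_tendsto_inner hTc hB hweak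
  have hTjw : ∀ j : ℕ, Tendsto (fun n => (T ^ (j + 1)) (w n)) atTop (𝓝 ((T ^ (j + 1)) z)) := fun j => by
    have e : ∀ u : H, (T ^ (j + 1)) u = (T ^ j) (T u) := fun u => by
      rw [pow_succ]; rfl
    simp_rw [e]
    exact ((T ^ j).continuous.tendsto _).comp hTw
  -- pass (9) to the limit for j + 1
  have horth : ∀ j : ℕ, ⟪x₀ - z, (T ^ (j + 1)) z⟫_ℂ = 0 := fun j => by
    have h1 : Tendsto (fun n => ⟪x₀ - w n, (T ^ (j + 1)) (w n)⟫_ℂ) atTop (𝓝 ⟪x₀ - z, (T ^ (j + 1)) z⟫_ℂ) :=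
      tendsto_inner_of_tendsto_inner_of_tendsto hB' hweak' (hTjw j)
    have h2 : Tendsto (fun n => ‖⟪x₀ - w n, (T ^ (j + 1)) (w n)⟫_ℂ‖) atTop (𝓝 0) :=
      squeeze_zero (fun n => norm_nonneg _) (fun n => h n (j + 1)) hε
    exact norm_eq_zero.mp (tendsto_nhds_unique h1.norm h2)
  -- non-degeneracy of the limit
  have hz : z ≠ 0 :=
    weakLimit_ne_zero (by norm_num) hweak fun n => re_inner_ge_of_norm_sub_le hx₀ (hdist n).2
  have hxz : x₀ - z ≠ 0 :=
    sub_weakLimit_ne_zero hx₀ (fun n => (hdist n).1) hweak hε fun n => by simpa using h n 0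
  have hTz : T z ≠ 0 := fun h0 => hz (hT (by rw [h0, map_zero]))
  refine hasNontrivialClosedInvariantSubspace_of_orbit_orthogonal' T hTz hxz fun j => ?_
  have e : (T ^ j) (T z) = (T ^ (j + 1)) z := by rw [pow_succ]; rfl
  rw [e]
  exact horth j

/-- The same with the weakly convergent subsequence extracted inside Lean (bounded sequences in a Hilbert space have
weakly convergent subsequences, `Literature.Analysis.InnerProduct.exists_strictMono_tendsto_inner_of_norm_le`): for a
compact injective `T`, ANY sequence of MC outputs as on p.4 of the manuscript yields a non-trivial closed invariant
subspace. [cite: Enflo2023, v2 p.4 (11) and p.20] -/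
theorem hasNontrivialClosedInvariantSubspace_of_isCompactOperator_MC [CompleteSpace H] (T : H →L[ℂ] H)
    (hTc : IsCompactOperator T) (hT : Function.Injective T) (x₀ : H) (hx₀ : ‖x₀‖ = 1)
    (w : ℕ → H) (ε : ℕ → ℝ)
    (hdist : ∀ n, 0.3 ≤ ‖x₀ - w n‖ ∧ ‖x₀ - w n‖ ≤ 0.7)
    (hε : Tendsto ε atTop (𝓝 0))
    (h : ∀ n j, ‖⟪x₀ - w n, (T ^ j) (w n)⟫_ℂ‖ ≤ ε n) :
    HasNontrivialClosedInvariantSubspace T := by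
  have hB : ∀ n, ‖w n‖ ≤ 1.7 := fun n => norm_le_of_norm_sub_le hx₀ (hdist n).2
  obtain ⟨φ, z, hφ, -, hweak⟩ :=
    Literature.Analysis.InnerProduct.exists_strictMono_tendsto_inner_of_norm_le (𝕜 := ℂ) hB
  exact hasNontrivialClosedInvariantSubspace_of_isCompactOperator_weakMC T hTc hT x₀ hx₀ (w ∘ φ) z (ε ∘ φ)
    (fun n => hdist (φ n)) hweak (hε.comp hφ.tendsto_atTop) fun n j => h (φ n) j

end Literature.Analysis.OperatorTheory.Enflo2023
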